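import Summits.QuantumFields.YangMills.Theorems.UnitScaleTiltProp7CurvedLandauCoreFibreT3
import Summits.QuantumFields.YangMills.Theorems.UnitScaleTiltProp7RelPlaqVsCovCurl
import HarnessLib

/-!
# Route `UnitScaleTilt`, crux K1 «MinimiserStabilityRegPr» (stmt-QuantumFields-19200), route-R [RP] curved — THE CURVED CORE ON THE FIBRE IN THE (ii′) CURRENCY:
# ✓ `…CurvedLandauCoreFibreT3` with the covariant curl energy converted to RELATIVE PLAQUETTES by ★w4-19200's brick (c) (✓ p605008 `sum_hs_curl_le_relPlaq_T3`):
# `((1∕2)ℓ⁻² − A·δ − A·(24576s² + 768ε²ℓ⁻⁴))·Σ‖WU₀* − 1‖² − A·Z − 96ℓ⁻¹·Z_Q ≤ 4A·Σ_p‖W(∂p)U₀(∂p)* − 1‖²`, `A = 18 + 76800L⁴`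

Cell `ym3-torus`, keyed width hand `ym-routeR-w3` (D-0154 (3c)); sequel of ✓ p620485 `…CurvedLandauCoreFibreT3`; the composition pattern is ★routeR-w3 g0's ✓ p607476 §2.
THEOREMS ONLY (0 `def`, 0 `sorry`); `--supports stmt-QuantumFields-19200`, count-neutral.  YM₃ on T³ is a ladder rung (R3), not the Clay problem; nothing here claims the stub,
the crux, d = 4 or the mass gap.

WHAT IS PROVED (ns `…Theorems.Prop7CurvedLandauCoreFibreRelPlaqT3`): ★★★ `relPoincare_core_of_fibre_T3` — the (ii′)-shape relative Poincaré inequality for a competitor `W` on the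
(0.4)-fibre of `U₀` with `‖WU₀* − 1‖ ≤ s ≤ 1` bondwise, modulo the residual binders of the 09:18Z census ((δ, Z) divergence budget, ★routeR-w2's `hΛcurl`, per-level `μ_j`,
the masses inside `Z_Q`).  HONEST SCOPE: `linarith` over two landed theorems.

References: T. Bałaban, CMP 102 (1985) 277–309 [Balaban1985Variational] ((14)–(15) p.280, (141)–(143) p.299); CMP 99 (1985) 389–434 [Balaban1985BackgroundPropagators] (Thm 3.11 p.416).
-/

set_option autoImplicit false

noncomputable section

open scoped BigOperators Matrix.Norms.L2Operator Matrix

namespace Summit.QuantumFields.YangMills.Theorems.Prop7CurvedLandauCoreFibreRelPlaqT3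

open Literature.MathematicalPhysics.QuantumFieldTheory.Balaban1983to89
open Literature.MathematicalPhysics.QuantumFieldTheory.Balaban1983to89.T3ContinuumYM3Torus
open Finset T4Continuum T4ReflectionCone BlockAveraging AveragingRT ExpMeanLog BlockAveragingEMLLinearised BlockAveragingEMLLinearisedBackground
  BlockAveragingEMLProp2 B1RG242Torus
open B15DeterminingSets (embIter)
open B7Prop1Explicit (treeWord)
open B7Eq78Linearization (conjR)
open B9Eq39Adjoint (curl divB)
open B10Eq27TorusAxialLog (holT unitsField toUField)
open B9TorusCalculus (torusT)
open Summit.QuantumFields.YangMills.Theorems.Prop7CurvedLandauCoreFibreT3 (sum_normSq_le_curl_sq_core_of_fibre_T3)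
open Summit.QuantumFields.YangMills.Theorems.Prop7RelPlaqVsCovCurl (sum_hs_curl_le_relPlaq_T3)

/-- ★★★ **THE CURVED CORE ON THE (0.4)-FIBRE, (ii′) CURRENCY.**  As ✓ `sum_normSq_le_curl_sq_core_of_fibre_T3`, plus `‖WU₀* − 1‖ ≤ s ≤ 1` bondwise; the covariant curl energy of
`Y = pertVar U₀ W` is at most `4Σ_p‖R_p − 1‖² + (24576s² + 768ε²ℓ⁻⁴)Σ‖Y‖²` (✓ p605008), whence
`((1∕2)ℓ⁻² − Aδ − A(24576s² + 768(εℓ⁻²)²))·Σ‖Y‖² − A·Z − 96ℓ⁻¹·Z_Q ≤ A·4·Σ_p‖W(∂p)·U₀(∂p)* − 1‖²`, `A = 18 + 76800L⁴`.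
[cite: Balaban1985Variational, (141)-(143) p.299; Balaban1985BackgroundPropagators, Thm 3.11 p.416] -/
theorem relPoincare_core_of_fibre_T3 (F : T3Family) (n K : ℕ)
    (U₀ W : GaugeField (F.P K) 0 (Matrix.specialUnitaryGroup (Fin 2) ℂ)) {ε : ℝ} (hε : 0 < ε) (hεL : 20000000000000 * (F.L : ℝ) ^ 9 * ε ≤ 1)
    (hU : ∀ p : Plaq (F.P K) 0, dist1 (GaugeField.plaqHol U₀ p) ≤ ε * (((F.L : ℝ) ^ (K - n)) ^ 2)⁻¹)
    (hfib : Averaging.iter (fun i => blockAvg (P := F.P K) (j := i) (expMeanLogSU (n := Fin 2))) (K - n) W = Averaging.iter (fun i => blockAvg (P := F.P K) (j := i) (expMeanLogSU (n := Fin 2))) (K - n) U₀)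
    (Q : (k : ℕ) → (PBond (F.P K) 0 → Matrix (Fin 2) (Fin 2) ℂ) → PBond (F.P K) k → Matrix (Fin 2) (Fin 2) ℂ) (hQ0 : ∀ Y, Q 0 Y = Y)
    (hQs : ∀ (k : ℕ) (Y : PBond (F.P K) 0 → Matrix (Fin 2) (Fin 2) ℂ) (c : PBond (F.P K) (k + 1)), Q (k + 1) Y c
      = fderiv ℂ (eml : (Idx (F.P K) → Matrix (Fin 2) (Fin 2) ℂ) → Matrix (Fin 2) (Fin 2) ℂ)
            (fun i => ((loopHol (Averaging.iter (fun i => blockAvg (P := F.P K) (j := i) (expMeanLogSU (n := Fin 2))) k U₀) c i :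
              Matrix.specialUnitaryGroup (Fin 2) ℂ) : Matrix (Fin 2) (Fin 2) ℂ))
            (fun i => covWalkSum (Averaging.iter (fun i => blockAvg (P := F.P K) (j := i) (expMeanLogSU (n := Fin 2))) k U₀) (Q k Y)
                (walk (emb c.src) (loopWord (F.P K).L c.dir (off i.1) i.2.1 i.2.2))
              * ((loopHol (Averaging.iter (fun i => blockAvg (P := F.P K) (j := i) (expMeanLogSU (n := Fin 2))) k U₀) c i :
                Matrix.specialUnitaryGroup (Fin 2) ℂ) : Matrix (Fin 2) (Fin 2) ℂ))
            * star ((corr (expMeanLogSU (n := Fin 2)) (Averaging.iter (fun i => blockAvg (P := F.P K) (j := i) (expMeanLogSU (n := Fin 2))) k U₀) c :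
                Matrix.specialUnitaryGroup (Fin 2) ℂ) : Matrix (Fin 2) (Fin 2) ℂ)
          + ((corr (expMeanLogSU (n := Fin 2)) (Averaging.iter (fun i => blockAvg (P := F.P K) (j := i) (expMeanLogSU (n := Fin 2))) k U₀) c :
                Matrix.specialUnitaryGroup (Fin 2) ℂ) : Matrix (Fin 2) (Fin 2) ℂ)
            * covWalkSum (Averaging.iter (fun i => blockAvg (P := F.P K) (j := i) (expMeanLogSU (n := Fin 2))) k U₀) (Q k Y)
                (walk (emb c.src) (List.replicate (F.P K).L (c.dir, true)))
            * star ((corr (expMeanLogSU (n := Fin 2)) (Averaging.iter (fun i => blockAvg (P := F.P K) (j := i) (expMeanLogSU (n := Fin 2))) k U₀) c :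
                Matrix.specialUnitaryGroup (Fin 2) ℂ) : Matrix (Fin 2) (Fin 2) ℂ))
    (G S : (k : ℕ) → PBond (F.P K) k → Matrix (Fin 2) (Fin 2) ℂ) (Λ : (k : ℕ) → Site (F.P K) k → Matrix (Fin 2) (Fin 2) ℂ)
    (hG0 : ∀ b, G 0 b = pertVar U₀ W b) (hS0 : ∀ b, S 0 b = pertVar U₀ W b) (hΛ0 : ∀ x, Λ 0 x = 0)
    (hΛs : ∀ (k : ℕ) (z : Site (F.P K) (k + 1)), Λ (k + 1) z
      = ((Fintype.card (Idx (F.P K)) : ℂ))⁻¹ • ∑ i : Idx (F.P K),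
          covWalkSum (Averaging.iter (fun i => blockAvg (P := F.P K) (j := i) (expMeanLogSU (n := Fin 2))) k U₀) (G k)
            (walk (emb z) (stairWord i.2.1 (off i.1)))
        + Λ k (emb z))
    (hGs : ∀ (k : ℕ) (c : PBond (F.P K) (k + 1)), G (k + 1) c
      = (fderiv ℂ (eml : (Idx (F.P K) → Matrix (Fin 2) (Fin 2) ℂ) → Matrix (Fin 2) (Fin 2) ℂ)
            (fun i => ((loopHol (Averaging.iter (fun i => blockAvg (P := F.P K) (j := i) (expMeanLogSU (n := Fin 2))) k U₀) c i :
              Matrix.specialUnitaryGroup (Fin 2) ℂ) : Matrix (Fin 2) (Fin 2) ℂ))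
            (fun i => covWalkSum (Averaging.iter (fun i => blockAvg (P := F.P K) (j := i) (expMeanLogSU (n := Fin 2))) k U₀) (G k)
                (walk (emb c.src) (loopWord (F.P K).L c.dir (off i.1) i.2.1 i.2.2))
              * ((loopHol (Averaging.iter (fun i => blockAvg (P := F.P K) (j := i) (expMeanLogSU (n := Fin 2))) k U₀) c i :
                Matrix.specialUnitaryGroup (Fin 2) ℂ) : Matrix (Fin 2) (Fin 2) ℂ))
            * star ((corr (expMeanLogSU (n := Fin 2)) (Averaging.iter (fun i => blockAvg (P := F.P K) (j := i) (expMeanLogSU (n := Fin 2))) k U₀) c :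
                Matrix.specialUnitaryGroup (Fin 2) ℂ) : Matrix (Fin 2) (Fin 2) ℂ)
          + ((corr (expMeanLogSU (n := Fin 2)) (Averaging.iter (fun i => blockAvg (P := F.P K) (j := i) (expMeanLogSU (n := Fin 2))) k U₀) c :
                Matrix.specialUnitaryGroup (Fin 2) ℂ) : Matrix (Fin 2) (Fin 2) ℂ)
            * covWalkSum (Averaging.iter (fun i => blockAvg (P := F.P K) (j := i) (expMeanLogSU (n := Fin 2))) k U₀) (G k)
                (walk (emb c.src) (List.replicate (F.P K).L (c.dir, true)))
            * star ((corr (expMeanLogSU (n := Fin 2)) (Averaging.iter (fun i => blockAvg (P := F.P K) (j := i) (expMeanLogSU (n := Fin 2))) k U₀) c :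
                Matrix.specialUnitaryGroup (Fin 2) ℂ) : Matrix (Fin 2) (Fin 2) ℂ))
        - ((((Fintype.card (Idx (F.P K)) : ℂ))⁻¹ • ∑ i : Idx (F.P K),
              covWalkSum (Averaging.iter (fun i => blockAvg (P := F.P K) (j := i) (expMeanLogSU (n := Fin 2))) k U₀) (G k) (walk (emb c.src) (stairWord i.2.1 (off i.1))))
            - ((Averaging.iter (fun i => blockAvg (P := F.P K) (j := i) (expMeanLogSU (n := Fin 2))) (k + 1) U₀ c : Matrix.specialUnitaryGroup (Fin 2) ℂ) :
                Matrix (Fin 2) (Fin 2) ℂ)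
              * (((Fintype.card (Idx (F.P K)) : ℂ))⁻¹ • ∑ i : Idx (F.P K),
                  covWalkSum (Averaging.iter (fun i => blockAvg (P := F.P K) (j := i) (expMeanLogSU (n := Fin 2))) k U₀) (G k) (walk (emb c.tgt) (stairWord i.2.1 (off i.1))))
              * star ((Averaging.iter (fun i => blockAvg (P := F.P K) (j := i) (expMeanLogSU (n := Fin 2))) (k + 1) U₀ c :
                Matrix.specialUnitaryGroup (Fin 2) ℂ) : Matrix (Fin 2) (Fin 2) ℂ)))
    (hSs : ∀ (k : ℕ) (c : PBond (F.P K) (k + 1)), S (k + 1) c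
      = ((Fintype.card (Idx (F.P K)) : ℂ))⁻¹ • ∑ i : Idx (F.P K),
          ((holAt (Averaging.iter (fun i => blockAvg (P := F.P K) (j := i) (expMeanLogSU (n := Fin 2))) k U₀) (walk (emb c.src) (stairWord i.2.1 (off i.1))) :
              Matrix.specialUnitaryGroup (Fin 2) ℂ) : Matrix (Fin 2) (Fin 2) ℂ) *
            covWalkSum (Averaging.iter (fun i => blockAvg (P := F.P K) (j := i) (expMeanLogSU (n := Fin 2))) k U₀) (S k)
              (walk (walkEnd (emb c.src) (stairWord i.2.1 (off i.1))) (List.replicate (F.P K).L (c.dir, true))) *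
          star ((holAt (Averaging.iter (fun i => blockAvg (P := F.P K) (j := i) (expMeanLogSU (n := Fin 2))) k U₀) (walk (emb c.src) (stairWord i.2.1 (off i.1))) :
              Matrix.specialUnitaryGroup (Fin 2) ℂ) : Matrix (Fin 2) (Fin 2) ℂ))
    {δ Z : ℝ}
    (hdivB : (∑ x : Site (F.P K) 0, ∑ j : Fin 2, ∑ k : Fin 2,
            ‖(divB (torusT (F.P K) 0) (fun κ z => unitsField (toUField U₀) ⟨z, κ⟩) (fun κ z => pertVar U₀ W ⟨z, κ⟩) x) j k‖ ^ 2)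
      ≤ δ * (∑ b : PBond (F.P K) 0, ‖pertVar U₀ W b‖ ^ 2) + Z)
    (hΛcurl : ∑ y : Site (F.P K) (K - n), ‖Λ (K - n) y‖ ^ 2
      ≤ ((F.L : ℝ) ^ (K - n)) * (100 * (2 : ℝ) * (F.L : ℝ) ^ 4 * ((∑ x : Site (F.P K) 0, ∑ μ : Fin (F.P K).d, ∑ ν : Fin (F.P K).d,
            (if μ < ν then ∑ j : Fin 2, ∑ k : Fin 2,
              ‖(curl (torusT (F.P K) 0) (fun κ z => unitsField (toUField U₀) ⟨z, κ⟩) (fun κ z => pertVar U₀ W ⟨z, κ⟩) μ ν x) j k‖ ^ 2 else 0))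
          + (∑ x : Site (F.P K) 0, ∑ j : Fin 2, ∑ k : Fin 2,
            ‖(divB (torusT (F.P K) 0) (fun κ z => unitsField (toUField U₀) ⟨z, κ⟩) (fun κ z => pertVar U₀ W ⟨z, κ⟩) x) j k‖ ^ 2))
        + 1000000000 * (2 : ℝ) ^ 2 * (F.L : ℝ) ^ 9 * ε * (((F.L : ℝ) ^ (K - n)) ^ 2)⁻¹ * (∑ b : PBond (F.P K) 0, ‖pertVar U₀ W b‖ ^ 2)))
    (μ : ℕ → ℝ) (hμ0 : ∀ j < K - n, 0 ≤ μ j)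
    (hμ : ∀ j < K - n, ∀ c : PBond (F.P K) (j + 1), ((((F.P K).d + 2) * (F.P K).L : ℕ) : ℝ) * ∑ b ∈ (univ.filter (fun b : PBond (F.P K) j => blockOf b.src = c.src ∨ blockOf b.src = c.tgt)), ‖(pertVar (Averaging.iter (fun i => blockAvg (P := F.P K) (j := i) (expMeanLogSU (n := Fin 2))) j U₀) (Averaging.iter (fun i => blockAvg (P := F.P K) (j := i) (expMeanLogSU (n := Fin 2))) j W)) b‖ ≤ μ j)
    (hμ72 : ∀ j < K - n, 72 * μ j ≤ 1) (hμN : ∀ j < K - n, 3 * μ j + 1 / 24 < deltaSU (Fin 2))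
    {s : ℝ} (hδW : ∀ b : PBond (F.P K) 0, ‖pertVar U₀ W b‖ ≤ s) (hs1 : s ≤ 1) :
    ((1 / 2) * (((F.L : ℝ) ^ (K - n)) ^ 2)⁻¹ - (18 + 76800 * (F.L : ℝ) ^ 4) * δ
        - (18 + 76800 * (F.L : ℝ) ^ 4) * (24576 * s ^ 2 + 768 * (ε * (((F.L : ℝ) ^ (K - n)) ^ 2)⁻¹) ^ 2)) * (∑ b : PBond (F.P K) 0, ‖pertVar U₀ W b‖ ^ 2) - (18 + 76800 * (F.L : ℝ) ^ 4) * Z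
        - 96 * ((F.L : ℝ) ^ (K - n))⁻¹ * (Real.exp ((159 * ((((F.P K).d + 2) * (F.P K).L : ℕ) : ℝ) * Real.sqrt (2 * (F.P K).d * (((F.P K).L : ℝ)) ^ (F.P K).d * (2 * (F.P K).d))) / Real.sqrt (((((F.P K).L : ℝ)) ^ (F.P K).d)⁻¹ * (((F.P K).L : ℝ)) ^ 2) * ∑ i ∈ Finset.range (K - n), (((((F.P K).d + 2) * (F.P K).L : ℕ) : ℝ) ^ 2 / 2 * (2 * ε) * ((((F.P K).L : ℝ)) ^ (2 * i) / (((F.P K).L : ℝ)) ^ (2 * (K - n))))) * (∑ i ∈ Finset.range (K - n), Real.sqrt (((((F.P K).L : ℝ)) ^ (F.P K).d)⁻¹ * (((F.P K).L : ℝ)) ^ 2) ^ ((K - n) - 1 - i) * (260 * (μ i * (((((F.P K).d + 2) * (F.P K).L : ℕ) : ℝ) * Real.sqrt (2 * (F.P K).d * (((F.P K).L : ℝ)) ^ (F.P K).d * (2 * (F.P K).d)) * Real.sqrt (∑ b : PBond (F.P K) i, ‖(pertVar (Averaging.iter (fun i => blockAvg (P := F.P K) (j := i) (expMeanLogSU (n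 := Fin 2))) i U₀) (Averaging.iter (fun i => blockAvg (P := F.P K) (j := i) (expMeanLogSU (n := Fin 2))) i W)) b‖ ^ 2)))))
        + 2 * Real.sqrt (F.P K).d * ∑ j ∈ Finset.range (K - n), Real.sqrt (4 * (F.P K).d * ((((F.P K).d : ℝ) + 2) ^ 2 * (2 : ℕ) * (((F.P K).L : ℝ)) ^ 4) + (4 * (((F.P K).d : ℝ) + 2) ^ 2 * ((F.P K).d : ℝ) ^ 3 * (3 * (2 : ℕ) + 2 * (F.P K).d) * (((F.P K).L : ℝ)) ^ 6) * (2 * (2 * ε)) ^ 2) * (Real.exp ((159 * ((((F.P K).d + 2) * (F.P K).L : ℕ) : ℝ) * Real.sqrt (2 * (F.P K).d * (((F.P K).L : ℝ)) ^ (F.P K).d * (2 * (F.P K).d))) / Real.sqrt (((((F.P K).L : ℝ)) ^ (F.P K).d)⁻¹ * (((F.P K).L : ℝ)) ^ 2) * ∑ i ∈ Finset.range j, (((((F.P K).d + 2) * (F.P K).L : ℕ) : ℝ) ^ 2 / 2 * (2 * ε) * ((((F.P K).L : ℝ)) ^ (2 * i) / (((F.P K).L : ℝ)) ^ (2 * (K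 - n))))) * (∑ i ∈ Finset.range j, Real.sqrt (((((F.P K).L : ℝ)) ^ (F.P K).d)⁻¹ * (((F.P K).L : ℝ)) ^ 2) ^ (j - 1 - i) * (260 * (μ i * (((((F.P K).d + 2) * (F.P K).L : ℕ) : ℝ) * Real.sqrt (2 * (F.P K).d * (((F.P K).L : ℝ)) ^ (F.P K).d * (2 * (F.P K).d)) * Real.sqrt (∑ b : PBond (F.P K) i, ‖(pertVar (Averaging.iter (fun i => blockAvg (P := F.P K) (j := i) (expMeanLogSU (n := Fin 2))) i U₀) (Averaging.iter (fun i => blockAvg (P := F.P K) (j := i) (expMeanLogSU (n := Fin 2))) i W)) b‖ ^ 2))))))) ^ 2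
      ≤ (18 + 76800 * (F.L : ℝ) ^ 4) * (4 * ∑ p : Plaq (F.P K) 0,
        ‖((GaugeField.plaqHol W p : Matrix.specialUnitaryGroup (Fin 2) ℂ) : Matrix (Fin 2) (Fin 2) ℂ)
          * star ((GaugeField.plaqHol U₀ p : Matrix.specialUnitaryGroup (Fin 2) ℂ) : Matrix (Fin 2) (Fin 2) ℂ) - 1‖ ^ 2) := by
  have hcore := sum_normSq_le_curl_sq_core_of_fibre_T3 F n K U₀ W hε hεL hU hfib Q hQ0 hQs G S Λ hG0 hS0 hΛ0 hΛs hGs hSs hdivB hΛcurl μ hμ0 hμ hμ72 hμN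
  have hδ' : ∀ b : PBond (F.P K) 0, ‖(W b : Matrix (Fin 2) (Fin 2) ℂ) * star (U₀ b : Matrix (Fin 2) (Fin 2) ℂ) - 1‖ ≤ s := fun b => by
    rw [← pertVar_eq]; exact hδW b
  have hc := sum_hs_curl_le_relPlaq_T3 F n K W U₀ hU hδ' hs1
  simp only [← pertVar_eq] at hc
  have hA0 : (0 : ℝ) ≤ 18 + 76800 * (F.L : ℝ) ^ 4 := by positivity
  have hc' := mul_le_mul_of_nonneg_left hc hA0
  linarith only [hcore, hc']

end Summit.QuantumFields.YangMills.Theorems.Prop7CurvedLandauCoreFibreRelPlaqT3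

end
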